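import Summits.QuantumFields.BalabanUV.T4Continuum.Support.RegionGaugeResolventSplit

/-!
# T⁴ programme, spine node NE2 (U1a), sub-row Δ1 «NE2⁰-Dirichlet» — THE GAUGE SECTOR OF THE FAITHFUL PROPAGATOR, EXACTLY:
# `G·∂_Ω·R = ∂_Ω·G′·R`, `R·∂_Ωᴴ·G = R·G′·∂_Ωᴴ`, and on inputs with block-constant divergence the gauge term VANISHES
# (owner item O15-d «Δ1-VEC-SLICE-IDENTITIES», structural record)

Row NE2 OWNER (unit `b2b-balaban-t4-ne2-p1`, gen 15), companion of O15-a (`Support/RegionGaugeResolventSplit`, p238371).  The resolvent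
split writes Bałaban's gauge-fixed region operator as `Δ_a = Δ_loc − B̂K̂⁻¹B̂ᴴ`; THIS FILE records the exact INTERTWINING identities of
the gauge sector that go with it (kernel algebra on `RegionGaugeSlice.SliceData` data, then the region instance) — the model-level content
of [B9] (3.21)/(3.25) «R is the orthogonal projection onto Δ′_a N(Q′)» read on the PROPAGATOR `G = Δ_a⁻¹`:

 * §1 ABSTRACT (`SliceData Cu Dg Dp G Qs Qv Dg₁`, `Δ := gaugeFixed Cu Dg G Qs Qv a` invertible):
   `gaugeFixed_mulVec_Dg_of_ker` (`Q′λ = 0 ⟹ Δ(Dλ) = D(Δ′λ)` — on pure gauges in `N(Q′)` the vector operator IS the scalar one),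
   **`inv_gaugeFixed_mul_Dg_mul_gaugeR : Δ⁻¹·D·R = D·G′·R`** and its adjoint **`gaugeR_mul_DgH_mul_inv : R·Dᴴ·Δ⁻¹ = R·G′·Dᴴ`**
   (the `R`-part of the divergence of the propagator is the scalar propagator of the divergence), `gaugeR_mul_G_mul_QsH : R·G′·Q′ᴴ = 0`,
   hence **`gaugeR_DgH_inv_mulVec_eq_zero`**: `Dᴴf = Q′ᴴc ⟹ R·Dᴴ·(Δ⁻¹f) = 0` — such inputs are mapped INTO BAŁABAN's SLICE, where the gauge
   term vanishes: **`local_mulVec_inv_of_divergence`** `(CuᴴCu + a·QvᴴQv)(Δ⁻¹f) = f` (the propagator inverts the GAUGE-INVARIANT operator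
   there) and `localFixed(Δ⁻¹f) = f + D·Dᴴ·(Δ⁻¹f)`.
 * §2 THE REGION INSTANCE (`0 < a`, `0 < a′`, any union of unit blocks): the same five statements for `regionDeltaA`, `gradR`,
   `gaugeR (GOm) (QOm)`, `GOm`, `QOm` BY NAME.

HONEST FRAMING (T4-DAG p. 1).  Model level (`U = 1`, ONE region, ONE averaging scale, finite torus); [folklore] algebra over landed modules;
identities only — no estimate, no rate; NE2 (U1a) NOT proved; spine PROVED 0/9 unchanged; NOT [B9] (3.16)/(3.23)–(3.27) as printed; NOT infinite
volume / mass gap / Clay.  HONEST DEPENDENCY: continuum YM on T⁴ ⇐ BetaPertH ∧ nine spine estimates (0/9 proved); BetaPertH ⇐ (D1) ∧ (D4) ∧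
CAP+tail; G-an2-4 gates asym, D1 and NE2/3/4.  No `sorry`.
-/

noncomputable section

open scoped BigOperators ComplexConjugate Matrix Matrix.Norms.L2Operator

namespace Summit.QuantumFields.BalabanUV.T4Continuum.RegionGaugeSliceIdentities

open Literature.MathematicalPhysics.QuantumFieldTheory.Balaban1983to89.B5Prop11Plancherel (Tor fine)
open Summit.QuantumFields.BalabanUV.T4Continuum
open Summit.QuantumFields.BalabanUV.T4Continuum.RegionGaugeProjection (gramK gaugeP gaugeR gaugeR_isHermitian gaugeP_mul_G_mul_QH
  gaugeR_mulVec_D_mulVec Q_mulVec_G_mulVec_gaugeR)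
open Summit.QuantumFields.BalabanUV.T4Continuum.RegionGaugeSlice (gaugeFixed gaugeFixed_isHermitian SliceData)
open Summit.QuantumFields.BalabanUV.T4Continuum.RegionScalarCompression (QOm GOm GOm_isHermitian isUnit_det_gramK_region)
open Summit.QuantumFields.BalabanUV.T4Continuum.RegionGaugeFixedVector (starReg curlR gradR avgR regionDeltaA sliceData_region)
open Summit.QuantumFields.BalabanUV.T4Continuum.RegionGaugeFixedVectorFlat (isUnit_det_regionDeltaA)
open Summit.QuantumFields.BalabanUV.T4Continuum.RegionGaugeResolventSplit (localFixed gaugeFixed_eq_localFixed_sub)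
open Summit.QuantumFields.BalabanUV.Beta.GAN24.DirichletBoxCompression (DOm)
open Summit.QuantumFields.BalabanUV.Beta.GAN24.DirichletBoxTrace (blockReg)

variable {d : ℕ}

/-! ## §1 Abstract: the gauge sector of the inverse of Bałaban's gauge-fixed operator -/

section Abstract

variable {m v w u uv : Type*} [Fintype m] [DecidableEq m] [Fintype v] [DecidableEq v] [Fintype u] [DecidableEq u]
  [Fintype w] [Fintype uv]
variable {Cu : Matrix w v ℂ} {Dg : Matrix v m ℂ} {Dp G : Matrix m m ℂ} {Qs : Matrix u m ℂ} {Qv : Matrix uv v ℂ} {Dg₁ : Matrix uv u ℂ}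
  (a : ℝ)

omit [DecidableEq v] in
/-- **ON PURE GAUGES IN `N(Q′)` THE VECTOR OPERATOR IS THE SCALAR ONE**: `Q′λ = 0 ⟹ Δ_a(Dλ) = D(Δ′λ)` (curl of a gradient vanishes,
`Q(Dλ) = D₁(Q′λ) = 0`, and `R` fixes `Δ′N(Q′)`). [cite: Balaban1985BackgroundPropagators, (3.21) p.394 (shape)] [folklore] -/
theorem gaugeFixed_mulVec_Dg_of_ker (h : SliceData Cu Dg Dp G Qs Qv Dg₁) (lam : m → ℂ) (hlam : Qs *ᵥ lam = 0) :
    gaugeFixed Cu Dg G Qs Qv a *ᵥ (Dg *ᵥ lam) = Dg *ᵥ (Dp *ᵥ lam) := by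
  have h1 : (Cuᴴ * Cu) *ᵥ (Dg *ᵥ lam) = 0 := by
    rw [Matrix.mulVec_mulVec, Matrix.mul_assoc, h.curl_grad, Matrix.mul_zero, Matrix.zero_mulVec]
  have h2 : ((a : ℂ) • (Qvᴴ * Qv)) *ᵥ (Dg *ᵥ lam) = 0 := by
    rw [Matrix.smul_mulVec, Matrix.mulVec_mulVec, Matrix.mul_assoc, h.avg_grad, ← Matrix.mul_assoc, ← Matrix.mulVec_mulVec, hlam,
      Matrix.mulVec_zero, smul_zero]
  have h3 : (Dg * gaugeR G Qs * Dgᴴ) *ᵥ (Dg *ᵥ lam) = Dg *ᵥ (Dp *ᵥ lam) := by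
    rw [← Matrix.mulVec_mulVec, ← Matrix.mulVec_mulVec, ← h.lap_of_ker lam hlam, gaugeR_mulVec_D_mulVec G Qs h.G_mul lam hlam]
  unfold gaugeFixed
  rw [Matrix.add_mulVec, Matrix.add_mulVec, h1, h2, h3, zero_add, add_zero]

omit [DecidableEq v] [Fintype w] [Fintype uv] in
/-- `R·G′·Q′ᴴ = 0` (the range of `G′Q′ᴴ` is the range of `P = 1 − R`). [folklore] -/
theorem gaugeR_mul_G_mul_QsH (h : SliceData Cu Dg Dp G Qs Qv Dg₁) : gaugeR G Qs * (G * Qsᴴ) = 0 := by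
  unfold gaugeR
  rw [Matrix.sub_mul, Matrix.one_mul, gaugeP_mul_G_mul_QH G Qs h.gram_unit, sub_self]

/-- **THE INTERTWINING IDENTITY** `Δ_a⁻¹·D·R = D·G′·R`: on `R`-projected scalars the vector propagator of a gradient is the gradient of
the scalar propagator. [cite: Balaban1985BackgroundPropagators, (3.21)/(3.25) p.394 (shape)] [folklore] -/
theorem inv_gaugeFixed_mul_Dg_mul_gaugeR (h : SliceData Cu Dg Dp G Qs Qv Dg₁) (hΔ : IsUnit (gaugeFixed Cu Dg G Qs Qv a).det) :
    (gaugeFixed Cu Dg G Qs Qv a)⁻¹ * Dg * gaugeR G Qs = Dg * G * gaugeR G Qs := by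
  -- `Δ·(D·G′·R) = D·R`, column by column: `Rf = Δ′λ` with `λ = G′Rf ∈ N(Q′)`
  have hDG : ∀ x : m → ℂ, Dp *ᵥ (G *ᵥ x) = x := fun x => by rw [Matrix.mulVec_mulVec, h.mul_G, Matrix.one_mulVec]
  have key : gaugeFixed Cu Dg G Qs Qv a * (Dg * G * gaugeR G Qs) = Dg * gaugeR G Qs := by
    refine Matrix.toLin'.injective (LinearMap.ext fun f => ?_)
    simp only [Matrix.toLin'_apply]
    have e1 : (gaugeFixed Cu Dg G Qs Qv a * (Dg * G * gaugeR G Qs)) *ᵥ f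
        = gaugeFixed Cu Dg G Qs Qv a *ᵥ (Dg *ᵥ (G *ᵥ (gaugeR G Qs *ᵥ f))) := by
      simp only [← Matrix.mulVec_mulVec]
    have e2 : (Dg * gaugeR G Qs) *ᵥ f = Dg *ᵥ (gaugeR G Qs *ᵥ f) := by rw [Matrix.mulVec_mulVec]
    rw [e1, e2, gaugeFixed_mulVec_Dg_of_ker a h _ (Q_mulVec_G_mulVec_gaugeR G Qs h.gram_unit f), hDG]
  calc (gaugeFixed Cu Dg G Qs Qv a)⁻¹ * Dg * gaugeR G Qs
      = (gaugeFixed Cu Dg G Qs Qv a)⁻¹ * (gaugeFixed Cu Dg G Qs Qv a * (Dg * G * gaugeR G Qs)) := by rw [key, Matrix.mul_assoc]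
    _ = Dg * G * gaugeR G Qs := by rw [← Matrix.mul_assoc, Matrix.nonsing_inv_mul _ hΔ, Matrix.one_mul]

/-- **THE ADJOINT INTERTWINING IDENTITY** `R·Dᴴ·Δ_a⁻¹ = R·G′·Dᴴ`: the `R`-part of the divergence of the vector propagator is the scalar
propagator applied to the divergence. [folklore] -/
theorem gaugeR_mul_DgH_mul_inv (h : SliceData Cu Dg Dp G Qs Qv Dg₁) (hΔ : IsUnit (gaugeFixed Cu Dg G Qs Qv a).det) :
    gaugeR G Qs * Dgᴴ * (gaugeFixed Cu Dg G Qs Qv a)⁻¹ = gaugeR G Qs * G * Dgᴴ := by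
  have hR := gaugeR_isHermitian G Qs h.herm
  have hΔh := gaugeFixed_isHermitian Cu Dg G Qs Qv a h.herm
  have e := congrArg Matrix.conjTranspose (inv_gaugeFixed_mul_Dg_mul_gaugeR a h hΔ)
  rw [Matrix.conjTranspose_mul, Matrix.conjTranspose_mul, Matrix.conjTranspose_mul, Matrix.conjTranspose_mul, hR.eq, h.herm.eq,
    Matrix.conjTranspose_nonsing_inv, hΔh.eq, ← Matrix.mul_assoc, ← Matrix.mul_assoc] at e
  exact e

/-- **INPUTS WITH BLOCK-CONSTANT DIVERGENCE ARE MAPPED INTO BAŁABAN's SLICE**: `Dᴴf = Q′ᴴc ⟹ R·Dᴴ·(Δ_a⁻¹f) = 0`. [folklore] -/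
theorem gaugeR_DgH_inv_mulVec_eq_zero (h : SliceData Cu Dg Dp G Qs Qv Dg₁) (hΔ : IsUnit (gaugeFixed Cu Dg G Qs Qv a).det)
    {f : v → ℂ} {c : u → ℂ} (hf : Dgᴴ *ᵥ f = Qsᴴ *ᵥ c) :
    gaugeR G Qs *ᵥ (Dgᴴ *ᵥ ((gaugeFixed Cu Dg G Qs Qv a)⁻¹ *ᵥ f)) = 0 := by
  rw [Matrix.mulVec_mulVec, Matrix.mulVec_mulVec, gaugeR_mul_DgH_mul_inv a h hΔ, ← Matrix.mulVec_mulVec, ← Matrix.mulVec_mulVec, hf,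
    Matrix.mulVec_mulVec, Matrix.mulVec_mulVec, Matrix.mul_assoc, gaugeR_mul_G_mul_QsH h, Matrix.zero_mulVec]

/-- **… AND THERE THE PROPAGATOR INVERTS THE GAUGE-INVARIANT OPERATOR**: `Dᴴf = Q′ᴴc ⟹ (CᴴC + a·QᴴQ)(Δ_a⁻¹f) = f`. [folklore] -/
theorem local_mulVec_inv_of_divergence (h : SliceData Cu Dg Dp G Qs Qv Dg₁) (hΔ : IsUnit (gaugeFixed Cu Dg G Qs Qv a).det)
    {f : v → ℂ} {c : u → ℂ} (hf : Dgᴴ *ᵥ f = Qsᴴ *ᵥ c) :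
    (Cuᴴ * Cu + (a : ℂ) • (Qvᴴ * Qv)) *ᵥ ((gaugeFixed Cu Dg G Qs Qv a)⁻¹ *ᵥ f) = f := by
  have h0 := gaugeR_DgH_inv_mulVec_eq_zero a h hΔ hf
  set x := (gaugeFixed Cu Dg G Qs Qv a)⁻¹ *ᵥ f with hx
  have e : gaugeFixed Cu Dg G Qs Qv a *ᵥ x = f := by
    rw [hx, Matrix.mulVec_mulVec, Matrix.mul_nonsing_inv _ hΔ, Matrix.one_mulVec]
  have split : gaugeFixed Cu Dg G Qs Qv a *ᵥ x
      = (Cuᴴ * Cu + (a : ℂ) • (Qvᴴ * Qv)) *ᵥ x + Dg *ᵥ (gaugeR G Qs *ᵥ (Dgᴴ *ᵥ x)) := by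
    simp only [gaugeFixed, Matrix.add_mulVec, ← Matrix.mulVec_mulVec]
    abel
  rw [split, h0, Matrix.mulVec_zero, add_zero] at e
  exact e

/-- the same read on the LOCAL operator of the resolvent split: `Dᴴf = Q′ᴴc ⟹ Δ_loc(Δ_a⁻¹f) = f + D·Dᴴ·(Δ_a⁻¹f)`. [folklore] -/
theorem localFixed_mulVec_inv_of_divergence (h : SliceData Cu Dg Dp G Qs Qv Dg₁) (hΔ : IsUnit (gaugeFixed Cu Dg G Qs Qv a).det)
    {f : v → ℂ} {c : u → ℂ} (hf : Dgᴴ *ᵥ f = Qsᴴ *ᵥ c) :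
    localFixed Cu Dg Qv a *ᵥ ((gaugeFixed Cu Dg G Qs Qv a)⁻¹ *ᵥ f) = f + (Dg * Dgᴴ) *ᵥ ((gaugeFixed Cu Dg G Qs Qv a)⁻¹ *ᵥ f) := by
  have e := local_mulVec_inv_of_divergence a h hΔ hf
  have split : localFixed Cu Dg Qv a *ᵥ ((gaugeFixed Cu Dg G Qs Qv a)⁻¹ *ᵥ f)
      = (Cuᴴ * Cu + (a : ℂ) • (Qvᴴ * Qv)) *ᵥ ((gaugeFixed Cu Dg G Qs Qv a)⁻¹ *ᵥ f)
        + (Dg * Dgᴴ) *ᵥ ((gaugeFixed Cu Dg G Qs Qv a)⁻¹ *ᵥ f) := by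
    simp only [localFixed, Matrix.add_mulVec]
    abel
  rw [split, e]

end Abstract

/-! ## §2 The region instance -/

section Region

variable (n : ℕ) [NeZero n] (M : Fin d → ℕ) [hM : ∀ μ, NeZero (M μ)] (a a' : ℝ) (S : Tor M → Prop) [DecidablePred S]

/-- **`G(Ω₀)·∂_Ω·R(Ω₀) = ∂_Ω·G′_Ω·R(Ω₀)`** for the faithful region operator (`0 < a`, `0 < a′`, any union of unit blocks). [folklore] -/
theorem inv_regionDeltaA_mul_gradR_mul_gaugeR (ha : 0 < a) (ha' : 0 < a') :
    (regionDeltaA n M a a' S)⁻¹ * gradR n M S * gaugeR (GOm n M a' S) (QOm n M S)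
      = gradR n M S * GOm n M a' S * gaugeR (GOm n M a' S) (QOm n M S) :=
  inv_gaugeFixed_mul_Dg_mul_gaugeR _ (sliceData_region n M a' S ha') (isUnit_det_regionDeltaA n M a a' S ha ha')

/-- **`R(Ω₀)·∂_Ωᴴ·G(Ω₀) = R(Ω₀)·G′_Ω·∂_Ωᴴ`**. [folklore] -/
theorem gaugeR_mul_gradRH_mul_inv_regionDeltaA (ha : 0 < a) (ha' : 0 < a') :
    gaugeR (GOm n M a' S) (QOm n M S) * (gradR n M S)ᴴ * (regionDeltaA n M a a' S)⁻¹
      = gaugeR (GOm n M a' S) (QOm n M S) * GOm n M a' S * (gradR n M S)ᴴ :=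
  gaugeR_mul_DgH_mul_inv _ (sliceData_region n M a' S ha') (isUnit_det_regionDeltaA n M a a' S ha ha')

/-- **A FIELD WHOSE REGION DIVERGENCE IS BLOCK-CONSTANT IS PROPAGATED INTO THE SLICE**: `∂_Ωᴴf = Q′_Ωᴴc ⟹ R(Ω₀)·∂_Ωᴴ·(G(Ω₀)f) = 0`. [folklore] -/
theorem gaugeR_gradRH_inv_mulVec_eq_zero (ha : 0 < a) (ha' : 0 < a') {f : {b // starReg n M S b} → ℂ} {c : {y // S y} → ℂ}
    (hf : (gradR n M S)ᴴ *ᵥ f = (QOm n M S)ᴴ *ᵥ c) :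
    gaugeR (GOm n M a' S) (QOm n M S) *ᵥ ((gradR n M S)ᴴ *ᵥ ((regionDeltaA n M a a' S)⁻¹ *ᵥ f)) = 0 :=
  gaugeR_DgH_inv_mulVec_eq_zero _ (sliceData_region n M a' S ha') (isUnit_det_regionDeltaA n M a a' S ha ha') hf

/-- **… AND ON IT THE FAITHFUL PROPAGATOR INVERTS THE GAUGE-INVARIANT OPERATOR** `curlRᴴcurlR + a n^d·avgRᴴavgR`. [folklore] -/
theorem invariant_mulVec_inv_of_divergence (ha : 0 < a) (ha' : 0 < a') {f : {b // starReg n M S b} → ℂ} {c : {y // S y} → ℂ}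
    (hf : (gradR n M S)ᴴ *ᵥ f = (QOm n M S)ᴴ *ᵥ c) :
    ((curlR n M S)ᴴ * curlR n M S + ((a * (n : ℝ) ^ d : ℝ) : ℂ) • ((avgR n M S)ᴴ * avgR n M S)) *ᵥ ((regionDeltaA n M a a' S)⁻¹ *ᵥ f)
      = f :=
  local_mulVec_inv_of_divergence _ (sliceData_region n M a' S ha') (isUnit_det_regionDeltaA n M a a' S ha ha') hf

end Region

end Summit.QuantumFields.BalabanUV.T4Continuum.RegionGaugeSliceIdentities

end
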